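import Literature.AlgebraicGeometry.ComplexMultiplication.CMTypeEigenlineCriterion
import HarnessLib

/-!
# The commutant of a CM algebra on `H¹(A(ℂ); ℚ)` is the CM algebra itself (Shimura, *Abelian Varieties with Complex Multiplication*, §5.1 Prop. 1; Deligne LNM 900 Example 3.7): `End_S(H¹) = S`, in particular it is commutative

Family `hodge`, layer `Literature/AlgebraicGeometry/ComplexMultiplication`. Research context: cell
`pub-hodge-ring2` (HONEST FRAMING: research route conditional on HC_CM; not a corollary; Q11.4-sentence-2
already refuted in dim ≥ 3), Literature lane, programme R4 («RM × CM»: the CM factor contributes an ABELIAN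
Lie algebra — Lombardo 2016 Lemma 3.4: «`H(B)` is a torus for `B` of CM type»). UNCONDITIONAL; theorems
only; no named fact; no step towards a summit statement.

PRINTED STATEMENT. Shimura (1998) §5.1 Proposition 1 and its proof: for an abelian variety `A` of dimension
`n` and a commutative semisimple `S ⊆ End⁰(A)` with `[S : ℚ] = 2n`, the rational representation makes
`H¹(A, ℚ)` (there `V = H₁`) a FREE `S`-MODULE OF RANK ONE, so that the commutant of `S` in `End_ℚ(V)` is
`S` («`End_S(V) = S ⊗ …`», the case `m = 1`); Deligne LNM 900 Example 3.7: «`H₁(A) ⊗ ℂ ≃ E ⊗_ℚ ℂ`» for `A`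
with complex multiplication by `E`. The tree has the freeness as
`CMTypeEigenlineCriterion.exists_bettiRep_apply_bijective` (`s ↦ s^* v₀ : S → H¹(A(ℂ); ℚ)` bijective).

RESULTS (for `S ⊆ End⁰(A)` commutative reduced with `dim_ℚ S = 2 dim A`, i.e. the witnesses of
`Milne1999.IsOfCMType A`):
* `exists_eq_unop_bettiRep_of_forall_commute` — **every `ℚ`-linear endomorphism of `H¹(A(ℂ); ℚ)`
  commuting with all `s^*`, `s ∈ S`, is itself of the form `s₀^*`**;
* `commute_of_forall_commute_bettiRep` — hence any two such endomorphisms commute (the input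
  `hF₂` of `Motives/HodgeThetaAnnihilatorSemisimpleTimesAbelian`);
* `IsOfCMType.exists_commutant_comm` — the same packaged over `Milne1999.IsOfCMType A`.

## References

* [Shimura1998] G. Shimura, *Abelian Varieties with Complex Multiplication and Modular Functions*,
  Princeton (1998), §5.1 Proposition 1 (and proof). [cite: Shimura1998, §5.1 Proposition 1]
* [Deligne1982HodgeCycles] P. Deligne, *Hodge cycles on abelian varieties*, LNM 900 (1982), Example 3.7,
  §5 Prop. 5.1. [cite: Deligne1982HodgeCycles, Example 3.7 and §5 Prop. 5.1]
* [Lombardo2016] D. Lombardo, Ann. Inst. Fourier 66 (2016), Lemma 3.4 (p. 1229). [cite: Lombardo2016, Lemma 3.4 (p. 1229)]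
-/

noncomputable section

open scoped TensorProduct
open CategoryTheory

namespace Literature.AlgebraicGeometry.ComplexMultiplication

open Literature.AlgebraicGeometry.Motives Literature.AlgebraicGeometry.HodgeTheory
open Literature.AlgebraicGeometry.Milne1999

section Commutant

variable {A : AbelianVariety ℂ}

/-- `s^* t^* = (t s)^* = (s t)^*` for `s, t` in a commutative `S ⊆ End⁰(A)` (the rational representation is
an anti-homomorphism). [cite: Shimura1998, §5.1 Proposition 1] -/
theorem unop_bettiRep_mul_unop_bettiRep_of_comm (S : Subalgebra ℚ A.endAlgebra)
    (hcomm : ∀ x ∈ S, ∀ y ∈ S, x * y = y * x) (s t : S) :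
    MulOpposite.unop (bettiRep A (s : A.endAlgebra)) * MulOpposite.unop (bettiRep A (t : A.endAlgebra)) =
      MulOpposite.unop (bettiRep A ((s * t : S) : A.endAlgebra)) := by
  rw [Subalgebra.coe_mul, hcomm s s.2 t t.2, map_mul, MulOpposite.unop_mul]

/-- **`End_S(H¹(A(ℂ); ℚ)) = S^*`**: for `S ⊆ End⁰(A)` commutative reduced of degree `2 dim A`, every
`ℚ`-linear endomorphism `Y` of `H¹(A(ℂ); ℚ)` commuting with all `s^*` (`s ∈ S`) is `s₀^*` for some `s₀ ∈ S`
(`H¹` is free of rank one over `S`: `Y v₀ = s₀^* v₀` for the cyclic vector `v₀`, and `Y`, `s₀^*` agree on the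
spanning orbit `S^* v₀`). [cite: Shimura1998, §5.1 Proposition 1] [cite: Deligne1982HodgeCycles, Example 3.7 and §5 Prop. 5.1] -/
theorem exists_eq_unop_bettiRep_of_forall_commute (S : Subalgebra ℚ A.endAlgebra)
    (hcomm : ∀ x ∈ S, ∀ y ∈ S, x * y = y * x) [IsReduced S] (hS : Module.finrank ℚ S = 2 * A.dim)
    {Y : Module.End ℚ (bettiCohomology A.X 1)}
    (hY : ∀ s : S, Y * MulOpposite.unop (bettiRep A (s : A.endAlgebra)) =
      MulOpposite.unop (bettiRep A (s : A.endAlgebra)) * Y) :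
    ∃ s₀ : S, Y = MulOpposite.unop (bettiRep A (s₀ : A.endAlgebra)) := by
  obtain ⟨v₀, hv₀⟩ := exists_bettiRep_apply_bijective S hcomm hS
  obtain ⟨s₀, hs₀⟩ := hv₀.2 (Y v₀)
  refine ⟨s₀, LinearMap.ext fun x => ?_⟩
  obtain ⟨s, rfl⟩ := hv₀.2 x
  change Y (MulOpposite.unop (bettiRep A (s : A.endAlgebra)) v₀) =
    MulOpposite.unop (bettiRep A (s₀ : A.endAlgebra)) (MulOpposite.unop (bettiRep A (s : A.endAlgebra)) v₀)
  have h1 := congrArg (fun f : Module.End ℚ (bettiCohomology A.X 1) => f v₀) (hY s)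
  simp only [Module.End.mul_apply] at h1
  change MulOpposite.unop (bettiRep A (s₀ : A.endAlgebra)) v₀ = Y v₀ at hs₀
  rw [h1, ← hs₀, ← Module.End.mul_apply, ← Module.End.mul_apply,
    unop_bettiRep_mul_unop_bettiRep_of_comm S hcomm, unop_bettiRep_mul_unop_bettiRep_of_comm S hcomm,
    show s * s₀ = s₀ * s from Subtype.ext (hcomm _ s.2 _ s₀.2)]

/-- **The commutant of `S^*` in `End_ℚ H¹(A(ℂ); ℚ)` is commutative** (it is `S^*`). This is the
abelianness of the CM factor used in Lombardo's `H(A × B) = H(A) × H(B)` («`H(B)` is a torus»).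
[cite: Shimura1998, §5.1 Proposition 1] [cite: Lombardo2016, Lemma 3.4 (p. 1229)] -/
theorem commute_of_forall_commute_bettiRep (S : Subalgebra ℚ A.endAlgebra)
    (hcomm : ∀ x ∈ S, ∀ y ∈ S, x * y = y * x) [IsReduced S] (hS : Module.finrank ℚ S = 2 * A.dim)
    (Y Y' : Module.End ℚ (bettiCohomology A.X 1))
    (hY : ∀ s : S, Y * MulOpposite.unop (bettiRep A (s : A.endAlgebra)) =
      MulOpposite.unop (bettiRep A (s : A.endAlgebra)) * Y)
    (hY' : ∀ s : S, Y' * MulOpposite.unop (bettiRep A (s : A.endAlgebra)) =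
      MulOpposite.unop (bettiRep A (s : A.endAlgebra)) * Y') :
    Y * Y' = Y' * Y := by
  obtain ⟨s₀, rfl⟩ := exists_eq_unop_bettiRep_of_forall_commute S hcomm hS hY
  exact (hY' s₀).symm

/-- **Packaged over `Milne1999.IsOfCMType A`**: a CM abelian variety carries a commutative reduced
`S ⊆ End⁰(A)` of degree `2 dim A` whose commutant on `H¹(A(ℂ); ℚ)` is commutative.
[cite: Shimura1998, §5.1 Proposition 1] [cite: Deligne1982HodgeCycles, Example 3.7 and §5 Prop. 5.1] -/
theorem IsOfCMType.exists_commutant_comm (hA : IsOfCMType A) :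
    ∃ S : Subalgebra ℚ A.endAlgebra, (∀ x ∈ S, ∀ y ∈ S, x * y = y * x) ∧
      ∀ Y Y' : Module.End ℚ (bettiCohomology A.X 1),
        (∀ s : S, Y * MulOpposite.unop (bettiRep A (s : A.endAlgebra)) =
          MulOpposite.unop (bettiRep A (s : A.endAlgebra)) * Y) →
        (∀ s : S, Y' * MulOpposite.unop (bettiRep A (s : A.endAlgebra)) =
          MulOpposite.unop (bettiRep A (s : A.endAlgebra)) * Y') → Y * Y' = Y' * Y := by
  obtain ⟨S, hr, hc, hd⟩ := hA
  haveI := hr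
  exact ⟨S, hc, fun Y Y' hY hY' => commute_of_forall_commute_bettiRep S hc hd Y Y' hY hY'⟩

end Commutant

end Literature.AlgebraicGeometry.ComplexMultiplication

end
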